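import Summits.AtomisticToContinuum.HydrodynamicLimit.Theorems.TwoClocksEquilibriumFastWindowLDBirthT12LorentzAngular
import Summits.AtomisticToContinuum.HydrodynamicLimit.Theorems.TwoClocksEquilibriumFastWindowLDBirthCollisionFrequencyUpper
import Summits.AtomisticToContinuum.HydrodynamicLimit.Theorems.EnskogAdjointDualityAdjointEnskogTestFamilyRPairGaussianMoments
import HarnessLib

/-!
# K2R refutation, stub `kappaOperator`: the test-side hard-sphere bracket on the corrector part

Route `EnskogAdjointDuality` of `AtomisticToContinuum/HydrodynamicLimit`, crux K2R
`AdjointEnskogTestFamilyR` (stmt-AtomisticToContinuum-11592), line `refutation`, registered stub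
`stub_kappaOperator`.

At a constant background (contact value `Y₀`, density `ρ₀`, Maxwellian `M = globalMaxwellian`, so that
`M(w) dw = stdGaussian`) the test-side Enskog bracket applied to the corrector part
`κ = g₁(v) + g₂(ω, ·)` of a test function reads
`E(v) = ∫_{S²} dσ(ω) ∫ dw q₊ Y₀ ρ₀ M(w) [g₁(v') + g₂(ω, w') − g₁(v) − g₂(ω, w)]`,
`q = ⟪v − w, ω⟫`, `v' = v − qω`, `w' = w + qω`.  For continuous `g₁, g₂` of quadratic growth we prove:

* each of the four pieces is integrable on the product `sphereMeasure × volume` (continuity, the bound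
  `q₊ ≤ |v| + |w|`, energy conservation `|v'|², |w'|² ≤ |v|² + |w|²`, and Gaussian moments;
  `k2r_ref_ko_integrable_piece`);
* the flux-moment budget `∫∫ q₊ M (1 + |w|²) ≤ 4π (4|v| + 9)` (hat-box identity `∫ q₊ dσ = π|v − w|` and the
  Gaussian moments `E|w|² = 3`, `E|w|⁴ = 15`; `k2r_ref_ko_flux_moment_le`);
* the identity `E(v) = Y₀ρ₀ (∫∫ q₊ M g₁(w') + ∫∫ q₊ M g₂(ω, w') − ν(v) g₁(v) − ∫∫ q₊ M g₂(ω, w))`, where the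
  local gain piece has been moved from `v'` to `w'` by the exchange symmetry of the hard-sphere gain term
  (`ClampedCorrectorBirth.gainFst_eq_gainSnd`) and the loss piece is the collision frequency
  `ν = collisionFrequency` of the linearised hard-sphere operator (`k2r_ref_ko_exchange`, `k2r_ref_ko_loss`).

References: C. Cercignani, R. Illner, M. Pulvirenti, *The Mathematical Theory of Dilute Gases* (1994),
§3.1 and §7.2 (2.13) [CIP1994].
-/

noncomputable section

open MeasureTheory Set Filter
open scoped InnerProductSpace Real

namespace Summit.AtomisticToContinuum.HydrodynamicLimit.Theorems.EnskogAdjointDuality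

open Literature.MathematicalPhysics.KineticTheory Literature.Analysis.FluidPDE
open Literature.Analysis.UnboundedOperators (collisionFrequency)

/-! ## Pointwise bounds -/

/-- The weight arithmetic `(a + b)(1 + a² + b²) ≤ (1 + a)³ (1 + b)³` for `a, b ≥ 0`. [folklore] -/
theorem k2r_ref_ko_weight_le {a b : ℝ} (ha : 0 ≤ a) (hb : 0 ≤ b) :
    (a + b) * (1 + a ^ 2 + b ^ 2) ≤ (1 + a) ^ 3 * (1 + b) ^ 3 := by
  have hab : 0 ≤ a * b := mul_nonneg ha hb
  calc (a + b) * (1 + a ^ 2 + b ^ 2) ≤ ((1 + a) * (1 + b)) * ((1 + a) * (1 + b)) ^ 2 :=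
        mul_le_mul (by nlinarith) (one_add_sq_add_sq_le ha hb) (by positivity) (by positivity)
    _ = (1 + a) ^ 3 * (1 + b) ^ 3 := by ring

/-- `0 ≤ ((v − w)·ω)₊ ≤ |v| + |w|` for a unit vector `ω`. [folklore] -/
theorem k2r_ref_ko_pos_le (v w : V3) (ω : Metric.sphere (0 : V3) 1) :
    max ⟪v - w, (ω : V3)⟫_ℝ 0 ≤ ‖v‖ + ‖w‖ := by
  have hω : ‖(ω : V3)‖ = 1 := norm_eq_of_mem_sphere ω
  refine max_le ?_ (by positivity)
  calc ⟪v - w, (ω : V3)⟫_ℝ ≤ |⟪v - w, (ω : V3)⟫_ℝ| := le_abs_self _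
    _ ≤ ‖v - w‖ * ‖(ω : V3)‖ := abs_real_inner_le_norm _ _
    _ ≤ ‖v‖ + ‖w‖ := by rw [hω, mul_one]; exact norm_sub_le _ _

/-- Energy conservation bounds both outgoing speeds: `|v'|², |w'|² ≤ |v|² + |w|²`. [cite: CIP1994, §3.1] -/
theorem k2r_ref_ko_norm_sq_out_le (v w : V3) (ω : Metric.sphere (0 : V3) 1) :
    ‖v - ⟪v - w, (ω : V3)⟫_ℝ • (ω : V3)‖ ^ 2 ≤ ‖v‖ ^ 2 + ‖w‖ ^ 2 ∧
      ‖w + ⟪v - w, (ω : V3)⟫_ℝ • (ω : V3)‖ ^ 2 ≤ ‖v‖ ^ 2 + ‖w‖ ^ 2 := by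
  have h := norm_sq_collide_fst_add_norm_sq_collide_snd ω (v, w)
  simp only [collide] at h
  constructor <;> nlinarith [sq_nonneg ‖v - ⟪v - w, (ω : V3)⟫_ℝ • (ω : V3)‖,
    sq_nonneg ‖w + ⟪v - w, (ω : V3)⟫_ℝ • (ω : V3)‖]

/-- Pointwise Gaussian domination of a bracket piece: if `|x| ≤ C (1 + |v|² + |w|²)` then
`|q₊ M(w) x| ≤ C (1+|v|)³ · (1+|w|)³ M(w)`. [folklore] -/
theorem k2r_ref_ko_piece_abs_le (v w : V3) (ω : Metric.sphere (0 : V3) 1) {C x : ℝ} (hC : 0 ≤ C)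
    (hx : |x| ≤ C * (1 + ‖v‖ ^ 2 + ‖w‖ ^ 2)) :
    |max ⟪v - w, (ω : V3)⟫_ℝ 0 * globalMaxwellian w * x| ≤
      C * (1 + ‖v‖) ^ 3 * ((1 + ‖w‖) ^ 3 * globalMaxwellian w) := by
  have hM : 0 ≤ globalMaxwellian w := (globalMaxwellian_pos w).le
  have hq0 : 0 ≤ max ⟪v - w, (ω : V3)⟫_ℝ 0 := le_max_right _ _
  have hq := k2r_ref_ko_pos_le v w ω
  have hwt := k2r_ref_ko_weight_le (norm_nonneg v) (norm_nonneg w)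
  rw [abs_mul, abs_mul, abs_of_nonneg hq0, abs_of_nonneg hM]
  calc max ⟪v - w, (ω : V3)⟫_ℝ 0 * globalMaxwellian w * |x|
      ≤ (‖v‖ + ‖w‖) * globalMaxwellian w * (C * (1 + ‖v‖ ^ 2 + ‖w‖ ^ 2)) := by gcongr
    _ = C * globalMaxwellian w * ((‖v‖ + ‖w‖) * (1 + ‖v‖ ^ 2 + ‖w‖ ^ 2)) := by ring
    _ ≤ C * globalMaxwellian w * ((1 + ‖v‖) ^ 3 * (1 + ‖w‖) ^ 3) := by gcongr
    _ = C * (1 + ‖v‖) ^ 3 * ((1 + ‖w‖) ^ 3 * globalMaxwellian w) := by ring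

/-! ## Product integrability of the bracket pieces -/

/-- A continuous function on `S² × ℝ³` dominated by `K (1+|w|)ⁿ M(w)` is integrable for
`sphereMeasure × volume` (finite sphere measure, Gaussian moments). [folklore] -/
theorem k2r_ref_ko_integrable_of_le {F : Metric.sphere (0 : V3) 1 × V3 → ℝ} (hF : Continuous F)
    {K : ℝ} {n : ℕ} (h : ∀ p, |F p| ≤ K * ((1 + ‖p.2‖) ^ n * globalMaxwellian p.2)) :
    Integrable F ((sphereMeasure : Measure (Metric.sphere (0 : V3) 1)).prod volume) := by
  haveI := isFiniteMeasure_sphereMeasure (E := V3)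
  have hG : Integrable (fun w : V3 => (1 + ‖w‖) ^ n * globalMaxwellian w) := by
    have h1 := integrable_one_add_norm_pow_mul_localMaxwellian one_pos (0 : V3) n
    rwa [localMaxwellian_one_one_zero] at h1
  exact ((hG.comp_snd sphereMeasure).const_mul K).mono' hF.aestronglyMeasurable
    (Eventually.of_forall fun p => by rw [Real.norm_eq_abs]; exact h p)

/-- **Integrability of a bracket piece.** For a continuous `G` on `S² × ℝ³` with
`|G(ω, w)| ≤ C (1 + |v|² + |w|²)`, the piece `(ω, w) ↦ q₊ M(w) G(ω, w)` is integrable on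
`sphereMeasure × volume`. [folklore] -/
theorem k2r_ref_ko_integrable_piece {G : Metric.sphere (0 : V3) 1 × V3 → ℝ} (hG : Continuous G)
    {C : ℝ} (hC : 0 ≤ C) (v : V3) (hb : ∀ p, |G p| ≤ C * (1 + ‖v‖ ^ 2 + ‖p.2‖ ^ 2)) :
    Integrable (fun p : Metric.sphere (0 : V3) 1 × V3 =>
        max ⟪v - p.2, (p.1 : V3)⟫_ℝ 0 * globalMaxwellian p.2 * G p)
      ((sphereMeasure : Measure (Metric.sphere (0 : V3) 1)).prod volume) := by
  refine k2r_ref_ko_integrable_of_le (K := C * (1 + ‖v‖) ^ 3) (n := 3) ?_ fun p =>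
    k2r_ref_ko_piece_abs_le v p.2 p.1 hC (hb p)
  have hM := continuous_globalMaxwellian (E := V3)
  fun_prop


/-! ## The angular integral, the exchange symmetry and the loss piece -/

/-- The hat-box identity `∫_{S²} (u·ω)₊ dσ(ω) = π |u|`. [cite: CIP1994, §3.1] -/
theorem k2r_ref_ko_sphere_integral (u : V3) :
    ∫ ω : Metric.sphere (0 : V3) 1, max ⟪u, (ω : V3)⟫_ℝ 0 ∂sphereMeasure = π * ‖u‖ := by
  have h := Literature.Analysis.UnboundedOperators.sphereIntegral_hardSphereKernel_zero u
  simp only [hardSphereKernel, sub_zero] at h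
  exact h

/-- **The loss piece**: `∫∫ q₊ M(w) x d(σ ⊗ dw) = ν(v) x`, `ν = collisionFrequency` (Fubini and
`M(w) dw = stdGaussian`). [cite: CIP1994, §7.2 (2.13)] -/
theorem k2r_ref_ko_loss (v : V3) (x : ℝ)
    (hint : Integrable (fun p : Metric.sphere (0 : V3) 1 × V3 =>
        max ⟪v - p.2, (p.1 : V3)⟫_ℝ 0 * globalMaxwellian p.2)
      ((sphereMeasure : Measure (Metric.sphere (0 : V3) 1)).prod volume)) :
    ∫ p : Metric.sphere (0 : V3) 1 × V3, max ⟪v - p.2, (p.1 : V3)⟫_ℝ 0 * globalMaxwellian p.2 * x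
        ∂((sphereMeasure : Measure (Metric.sphere (0 : V3) 1)).prod volume) =
      collisionFrequency v * x := by
  haveI := isFiniteMeasure_sphereMeasure (E := V3)
  rw [integral_mul_const]
  congr 1
  rw [integral_prod_symm _ hint]
  unfold collisionFrequency
  rw [integral_stdGaussian_eq_integral_mul_globalMaxwellian]
  refine integral_congr_ae (Eventually.of_forall fun w => ?_)
  simp only [hardSphereKernel]
  rw [integral_mul_const, mul_comm]

/-- **Exchange symmetry of the local gain piece**: `∫∫ q₊ M(w) g(v') = ∫∫ q₊ M(w) g(w')` on
`sphereMeasure × volume`, from the pointwise-in-`w` exchange symmetry of the hard-sphere gain term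
(`ClampedCorrectorBirth.gainFst_eq_gainSnd`) and Fubini. [cite: CIP1994, §3.1] -/
theorem k2r_ref_ko_exchange {g : V3 → ℝ} (hg : Measurable g) (v : V3)
    (h₁ : Integrable (fun p : Metric.sphere (0 : V3) 1 × V3 =>
        max ⟪v - p.2, (p.1 : V3)⟫_ℝ 0 * globalMaxwellian p.2 *
          g (v - ⟪v - p.2, (p.1 : V3)⟫_ℝ • (p.1 : V3)))
      ((sphereMeasure : Measure (Metric.sphere (0 : V3) 1)).prod volume))
    (h₂ : Integrable (fun p : Metric.sphere (0 : V3) 1 × V3 =>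
        max ⟪v - p.2, (p.1 : V3)⟫_ℝ 0 * globalMaxwellian p.2 *
          g (p.2 + ⟪v - p.2, (p.1 : V3)⟫_ℝ • (p.1 : V3)))
      ((sphereMeasure : Measure (Metric.sphere (0 : V3) 1)).prod volume)) :
    ∫ p : Metric.sphere (0 : V3) 1 × V3, max ⟪v - p.2, (p.1 : V3)⟫_ℝ 0 * globalMaxwellian p.2 *
          g (v - ⟪v - p.2, (p.1 : V3)⟫_ℝ • (p.1 : V3))
        ∂((sphereMeasure : Measure (Metric.sphere (0 : V3) 1)).prod volume) =
      ∫ p : Metric.sphere (0 : V3) 1 × V3, max ⟪v - p.2, (p.1 : V3)⟫_ℝ 0 * globalMaxwellian p.2 *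
          g (p.2 + ⟪v - p.2, (p.1 : V3)⟫_ℝ • (p.1 : V3))
        ∂((sphereMeasure : Measure (Metric.sphere (0 : V3) 1)).prod volume) := by
  haveI := isFiniteMeasure_sphereMeasure (E := V3)
  rw [integral_prod_symm _ h₁, integral_prod_symm _ h₂]
  refine integral_congr_ae (Eventually.of_forall fun w => ?_)
  have h := ClampedCorrectorBirth.gainFst_eq_gainSnd v w hg
  simp only [hardSphereKernel, collide] at h
  have e : ∀ (G : Metric.sphere (0 : V3) 1 → ℝ),
      ∫ ω : Metric.sphere (0 : V3) 1, max ⟪v - w, (ω : V3)⟫_ℝ 0 * globalMaxwellian w * G ω ∂sphereMeasure =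
        globalMaxwellian w * ∫ ω : Metric.sphere (0 : V3) 1, max ⟪v - w, (ω : V3)⟫_ℝ 0 * G ω ∂sphereMeasure := by
    intro G
    rw [← integral_const_mul]
    refine integral_congr_ae (Eventually.of_forall fun ω => ?_)
    simp only
    ring
  simp only
  rw [e (fun ω => g (v - ⟪v - w, (ω : V3)⟫_ℝ • (ω : V3))),
    e (fun ω => g (w + ⟪v - w, (ω : V3)⟫_ℝ • (ω : V3))), h]

/-! ## The flux-moment budget -/

/-- Gaussian moments of `ℝ³`: `∫ |w|² dγ = 3` and `∫ |w|⁴ dγ = 15`. [folklore] -/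
theorem k2r_ref_ko_gauss_moments :
    ∫ w, ‖w‖ ^ 2 ∂ProbabilityTheory.stdGaussian V3 = 3 ∧
      ∫ w, ‖w‖ ^ 4 ∂ProbabilityTheory.stdGaussian V3 = 15 := by
  constructor
  · rw [Literature.Probability.Distributions.integral_norm_sq_stdGaussian (EuclideanSpace.basisFun (Fin 3) ℝ),
      Fintype.card_fin]
    norm_num
  · rw [Literature.Probability.Distributions.integral_norm_pow_four_stdGaussian (EuclideanSpace.basisFun (Fin 3) ℝ),
      Fintype.card_fin]
    norm_num

/-- **The flux-moment budget** `∫∫ q₊ M(w) (1 + |w|²) d(σ ⊗ dw) ≤ 4π (4|v| + 9)`: the angular integral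
is `π|v − w| ≤ π(|v| + |w|)`, and `E[(|v| + |w|)(1 + |w|²)] ≤ 4|v| + 11` under the standard Gaussian
(`E|w|² = 3`, `E|w|⁴ = 15`, `|w| ≤ (1 + |w|²)/2`). [cite: CIP1994, §7.2 (2.13)] -/
theorem k2r_ref_ko_flux_moment_le (v : V3)
    (hint : Integrable (fun p : Metric.sphere (0 : V3) 1 × V3 =>
        max ⟪v - p.2, (p.1 : V3)⟫_ℝ 0 * globalMaxwellian p.2 * (1 + ‖p.2‖ ^ 2))
      ((sphereMeasure : Measure (Metric.sphere (0 : V3) 1)).prod volume)) :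
    ∫ p : Metric.sphere (0 : V3) 1 × V3, max ⟪v - p.2, (p.1 : V3)⟫_ℝ 0 * globalMaxwellian p.2 *
          (1 + ‖p.2‖ ^ 2) ∂((sphereMeasure : Measure (Metric.sphere (0 : V3) 1)).prod volume) ≤
      4 * π * (4 * ‖v‖ + 9) := by
  haveI := isFiniteMeasure_sphereMeasure (E := V3)
  set μ : Measure V3 := ProbabilityTheory.stdGaussian V3 with hμ
  -- Fubini and the hat-box identity
  have hF : ∫ p : Metric.sphere (0 : V3) 1 × V3, max ⟪v - p.2, (p.1 : V3)⟫_ℝ 0 * globalMaxwellian p.2 *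
        (1 + ‖p.2‖ ^ 2) ∂((sphereMeasure : Measure (Metric.sphere (0 : V3) 1)).prod volume) =
      ∫ w, π * ‖v - w‖ * (1 + ‖w‖ ^ 2) ∂μ := by
    rw [integral_prod_symm _ hint, hμ, integral_stdGaussian_eq_integral_mul_globalMaxwellian]
    refine integral_congr_ae (Eventually.of_forall fun w => ?_)
    simp only
    rw [integral_mul_const, integral_mul_const, k2r_ref_ko_sphere_integral]
    ring
  rw [hF]
  -- Gaussian moments
  obtain ⟨hI2, hI4⟩ := k2r_ref_ko_gauss_moments
  have hsq : Integrable (fun w : V3 => ‖w‖ ^ 2) μ :=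
    (ProbabilityTheory.IsGaussian.memLp_id μ 2 (by simp)).integrable_norm_pow (by norm_num)
  have h4 : Integrable (fun w : V3 => ‖w‖ ^ 4) μ :=
    (ProbabilityTheory.IsGaussian.memLp_id μ 4 (by simp)).integrable_norm_pow (by norm_num)
  have hA : Integrable (fun w : V3 => (‖v‖ + 1 / 2) + (‖v‖ + 1) * ‖w‖ ^ 2) μ :=
    (integrable_const _).add (hsq.const_mul _)
  have hB : Integrable (fun w : V3 => (‖v‖ + 1 / 2) + (‖v‖ + 1) * ‖w‖ ^ 2 + 1 / 2 * ‖w‖ ^ 4) μ :=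
    hA.add (h4.const_mul _)
  have hval : ∫ w, π * ((‖v‖ + 1 / 2) + (‖v‖ + 1) * ‖w‖ ^ 2 + 1 / 2 * ‖w‖ ^ 4) ∂μ = π * (4 * ‖v‖ + 11) := by
    rw [integral_const_mul, integral_add hA (h4.const_mul _), integral_add (integrable_const _) (hsq.const_mul _),
      integral_const, integral_const_mul, integral_const_mul, hI2, hI4, probReal_univ, one_smul]
    ring
  have hmono : ∫ w, π * ‖v - w‖ * (1 + ‖w‖ ^ 2) ∂μ ≤
      ∫ w, π * ((‖v‖ + 1 / 2) + (‖v‖ + 1) * ‖w‖ ^ 2 + 1 / 2 * ‖w‖ ^ 4) ∂μ := by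
    refine integral_mono_of_nonneg (Eventually.of_forall fun w => by positivity) (hB.const_mul _)
      (Eventually.of_forall fun w => ?_)
    have hd : ‖v - w‖ ≤ ‖v‖ + ‖w‖ := norm_sub_le v w
    have hb : 0 ≤ ‖w‖ := norm_nonneg w
    have ha : 0 ≤ ‖v‖ := norm_nonneg v
    have h1 : ‖v - w‖ * (1 + ‖w‖ ^ 2) ≤ (‖v‖ + ‖w‖) * (1 + ‖w‖ ^ 2) :=
      mul_le_mul_of_nonneg_right hd (by positivity)
    have h2 : (‖v‖ + ‖w‖) * (1 + ‖w‖ ^ 2) ≤ (‖v‖ + 1 / 2) + (‖v‖ + 1) * ‖w‖ ^ 2 + 1 / 2 * ‖w‖ ^ 4 := by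
      nlinarith [sq_nonneg (‖w‖ ^ 2 - ‖w‖), sq_nonneg (‖w‖ - 1)]
    have := h1.trans h2
    simp only
    nlinarith [Real.pi_pos]
  refine (hmono.trans_eq hval).trans ?_
  nlinarith [Real.pi_pos, norm_nonneg v]


/-! ## The registered stub -/

/-- **Registered stub `stub_kappaOperator`** (line `refutation` of crux K2R
`Summit.AtomisticToContinuum.HydrodynamicLimit.Theses.EnskogAdjointDuality.AdjointEnskogTestFamilyR`): the
test-side hard-sphere bracket at a constant Maxwellian background applied to the corrector part
`g₁(v) + g₂(ω, ·)` — product integrability of the four pieces, the flux-moment budget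
`∫∫ q₊ M (1+|w|²) ≤ 4π(4|v| + 9)`, and the gain/loss decomposition with the local gain piece moved onto
`w'` by the exchange symmetry and the loss piece expressed through `ν = collisionFrequency` — verbatim
registered signature. [cite: CIP1994, §3.1] -/
theorem stub_kappaOperator :
  ∀ (Y₀ ρ₀ C : ℝ) (g₁ : EuclideanSpace ℝ (Fin 3) → ℝ)
    (g₂ : Metric.sphere (0 : EuclideanSpace ℝ (Fin 3)) 1 × EuclideanSpace ℝ (Fin 3) → ℝ),
    Continuous g₁ → Continuous g₂ → (∀ u, |g₁ u| ≤ C * (1 + ‖u‖ ^ 2)) → (∀ ω u, |g₂ (ω, u)| ≤ C * (1 + ‖u‖ ^ 2)) →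
    ∀ v : EuclideanSpace ℝ (Fin 3),
    (Integrable (fun p : Metric.sphere (0 : EuclideanSpace ℝ (Fin 3)) 1 × EuclideanSpace ℝ (Fin 3) =>
        max (inner ℝ (v - p.2) (p.1 : EuclideanSpace ℝ (Fin 3))) 0 * globalMaxwellian p.2 *
          g₁ (p.2 + inner ℝ (v - p.2) (p.1 : EuclideanSpace ℝ (Fin 3)) • (p.1 : EuclideanSpace ℝ (Fin 3))))
        ((sphereMeasure : Measure (Metric.sphere (0 : EuclideanSpace ℝ (Fin 3)) 1)).prod volume)) ∧
    (Integrable (fun p : Metric.sphere (0 : EuclideanSpace ℝ (Fin 3)) 1 × EuclideanSpace ℝ (Fin 3) =>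
        max (inner ℝ (v - p.2) (p.1 : EuclideanSpace ℝ (Fin 3))) 0 * globalMaxwellian p.2 *
          g₂ (p.1, p.2 + inner ℝ (v - p.2) (p.1 : EuclideanSpace ℝ (Fin 3)) • (p.1 : EuclideanSpace ℝ (Fin 3))))
        ((sphereMeasure : Measure (Metric.sphere (0 : EuclideanSpace ℝ (Fin 3)) 1)).prod volume)) ∧
    (Integrable (fun p : Metric.sphere (0 : EuclideanSpace ℝ (Fin 3)) 1 × EuclideanSpace ℝ (Fin 3) =>
        max (inner ℝ (v - p.2) (p.1 : EuclideanSpace ℝ (Fin 3))) 0 * globalMaxwellian p.2 * g₂ (p.1, p.2))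
        ((sphereMeasure : Measure (Metric.sphere (0 : EuclideanSpace ℝ (Fin 3)) 1)).prod volume)) ∧
    (Integrable (fun p : Metric.sphere (0 : EuclideanSpace ℝ (Fin 3)) 1 × EuclideanSpace ℝ (Fin 3) =>
        max (inner ℝ (v - p.2) (p.1 : EuclideanSpace ℝ (Fin 3))) 0 * globalMaxwellian p.2 * (1 + ‖p.2‖ ^ 2))
        ((sphereMeasure : Measure (Metric.sphere (0 : EuclideanSpace ℝ (Fin 3)) 1)).prod volume)) ∧
    (∫ p : Metric.sphere (0 : EuclideanSpace ℝ (Fin 3)) 1 × EuclideanSpace ℝ (Fin 3),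
        max (inner ℝ (v - p.2) (p.1 : EuclideanSpace ℝ (Fin 3))) 0 * globalMaxwellian p.2 * (1 + ‖p.2‖ ^ 2)
        ∂((sphereMeasure : Measure (Metric.sphere (0 : EuclideanSpace ℝ (Fin 3)) 1)).prod volume)
      ≤ 4 * Real.pi * (4 * ‖v‖ + 9)) ∧
    (∫ ω : Metric.sphere (0 : EuclideanSpace ℝ (Fin 3)) 1, (∫ w : EuclideanSpace ℝ (Fin 3),
        max (inner ℝ (v - w) (ω : EuclideanSpace ℝ (Fin 3))) 0 * Y₀ * (ρ₀ * globalMaxwellian w) *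
          (g₁ (v - inner ℝ (v - w) (ω : EuclideanSpace ℝ (Fin 3)) • (ω : EuclideanSpace ℝ (Fin 3))) +
            g₂ (ω, w + inner ℝ (v - w) (ω : EuclideanSpace ℝ (Fin 3)) • (ω : EuclideanSpace ℝ (Fin 3))) -
            g₁ v - g₂ (ω, w))) ∂sphereMeasure) =
      Y₀ * ρ₀ * ((∫ p : Metric.sphere (0 : EuclideanSpace ℝ (Fin 3)) 1 × EuclideanSpace ℝ (Fin 3),
          max (inner ℝ (v - p.2) (p.1 : EuclideanSpace ℝ (Fin 3))) 0 * globalMaxwellian p.2 *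
            g₁ (p.2 + inner ℝ (v - p.2) (p.1 : EuclideanSpace ℝ (Fin 3)) • (p.1 : EuclideanSpace ℝ (Fin 3)))
          ∂((sphereMeasure : Measure (Metric.sphere (0 : EuclideanSpace ℝ (Fin 3)) 1)).prod volume)) +
        (∫ p : Metric.sphere (0 : EuclideanSpace ℝ (Fin 3)) 1 × EuclideanSpace ℝ (Fin 3),
          max (inner ℝ (v - p.2) (p.1 : EuclideanSpace ℝ (Fin 3))) 0 * globalMaxwellian p.2 *
            g₂ (p.1, p.2 + inner ℝ (v - p.2) (p.1 : EuclideanSpace ℝ (Fin 3)) • (p.1 : EuclideanSpace ℝ (Fin 3)))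
          ∂((sphereMeasure : Measure (Metric.sphere (0 : EuclideanSpace ℝ (Fin 3)) 1)).prod volume)) -
        collisionFrequency v * g₁ v -
        (∫ p : Metric.sphere (0 : EuclideanSpace ℝ (Fin 3)) 1 × EuclideanSpace ℝ (Fin 3),
          max (inner ℝ (v - p.2) (p.1 : EuclideanSpace ℝ (Fin 3))) 0 * globalMaxwellian p.2 * g₂ (p.1, p.2)
          ∂((sphereMeasure : Measure (Metric.sphere (0 : EuclideanSpace ℝ (Fin 3)) 1)).prod volume))) := by
  intro Y₀ ρ₀ C g₁ g₂ hg₁ hg₂ hb₁ hb₂ v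
  haveI := isFiniteMeasure_sphereMeasure (E := V3)
  have hC : 0 ≤ C := by
    have h := hb₁ 0
    rw [norm_zero] at h
    nlinarith [abs_nonneg (g₁ 0)]
  have hsq : ∀ (p : Metric.sphere (0 : V3) 1 × V3) {u : V3} {x : ℝ}, |x| ≤ C * (1 + ‖u‖ ^ 2) →
      ‖u‖ ^ 2 ≤ ‖v‖ ^ 2 + ‖p.2‖ ^ 2 → |x| ≤ C * (1 + ‖v‖ ^ 2 + ‖p.2‖ ^ 2) := fun p u x hx hu =>
    hx.trans (mul_le_mul_of_nonneg_left (by linarith) hC)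
  -- the bracket pieces are integrable on `sphereMeasure × volume`
  have I1 : Integrable (fun p : Metric.sphere (0 : V3) 1 × V3 =>
      max ⟪v - p.2, (p.1 : V3)⟫_ℝ 0 * globalMaxwellian p.2 *
        g₁ (p.2 + ⟪v - p.2, (p.1 : V3)⟫_ℝ • (p.1 : V3)))
      ((sphereMeasure : Measure (Metric.sphere (0 : V3) 1)).prod volume) :=
    k2r_ref_ko_integrable_piece (G := fun p => g₁ (p.2 + ⟪v - p.2, (p.1 : V3)⟫_ℝ • (p.1 : V3)))
      (by fun_prop) hC v fun p => hsq p (hb₁ _) (k2r_ref_ko_norm_sq_out_le v p.2 p.1).2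
  have I1' : Integrable (fun p : Metric.sphere (0 : V3) 1 × V3 =>
      max ⟪v - p.2, (p.1 : V3)⟫_ℝ 0 * globalMaxwellian p.2 *
        g₁ (v - ⟪v - p.2, (p.1 : V3)⟫_ℝ • (p.1 : V3)))
      ((sphereMeasure : Measure (Metric.sphere (0 : V3) 1)).prod volume) :=
    k2r_ref_ko_integrable_piece (G := fun p => g₁ (v - ⟪v - p.2, (p.1 : V3)⟫_ℝ • (p.1 : V3)))
      (by fun_prop) hC v fun p => hsq p (hb₁ _) (k2r_ref_ko_norm_sq_out_le v p.2 p.1).1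
  have I2 : Integrable (fun p : Metric.sphere (0 : V3) 1 × V3 =>
      max ⟪v - p.2, (p.1 : V3)⟫_ℝ 0 * globalMaxwellian p.2 *
        g₂ (p.1, p.2 + ⟪v - p.2, (p.1 : V3)⟫_ℝ • (p.1 : V3)))
      ((sphereMeasure : Measure (Metric.sphere (0 : V3) 1)).prod volume) :=
    k2r_ref_ko_integrable_piece (G := fun p => g₂ (p.1, p.2 + ⟪v - p.2, (p.1 : V3)⟫_ℝ • (p.1 : V3)))
      (by fun_prop) hC v fun p => hsq p (hb₂ _ _) (k2r_ref_ko_norm_sq_out_le v p.2 p.1).2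
  have I3 : Integrable (fun p : Metric.sphere (0 : V3) 1 × V3 =>
      max ⟪v - p.2, (p.1 : V3)⟫_ℝ 0 * globalMaxwellian p.2 * g₂ (p.1, p.2))
      ((sphereMeasure : Measure (Metric.sphere (0 : V3) 1)).prod volume) :=
    k2r_ref_ko_integrable_piece (G := fun p => g₂ (p.1, p.2)) (by fun_prop) hC v
      fun p => hsq p (hb₂ _ _) (by nlinarith [sq_nonneg ‖v‖])
  have I4 : Integrable (fun p : Metric.sphere (0 : V3) 1 × V3 =>
      max ⟪v - p.2, (p.1 : V3)⟫_ℝ 0 * globalMaxwellian p.2 * (1 + ‖p.2‖ ^ 2))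
      ((sphereMeasure : Measure (Metric.sphere (0 : V3) 1)).prod volume) :=
    k2r_ref_ko_integrable_piece (G := fun p => 1 + ‖p.2‖ ^ 2) (by fun_prop) zero_le_one v fun p => by
      rw [abs_of_nonneg (by positivity), one_mul]; nlinarith [sq_nonneg ‖v‖]
  have I0 : Integrable (fun p : Metric.sphere (0 : V3) 1 × V3 =>
      max ⟪v - p.2, (p.1 : V3)⟫_ℝ 0 * globalMaxwellian p.2)
      ((sphereMeasure : Measure (Metric.sphere (0 : V3) 1)).prod volume) := by
    have h := k2r_ref_ko_integrable_piece (G := fun _ => (1 : ℝ)) continuous_const zero_le_one v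
      fun p => by rw [abs_one, one_mul]; nlinarith [sq_nonneg ‖v‖, sq_nonneg ‖p.2‖]
    simpa only [mul_one] using h
  have I3' : Integrable (fun p : Metric.sphere (0 : V3) 1 × V3 =>
      max ⟪v - p.2, (p.1 : V3)⟫_ℝ 0 * globalMaxwellian p.2 * g₁ v)
      ((sphereMeasure : Measure (Metric.sphere (0 : V3) 1)).prod volume) := I0.mul_const _
  refine ⟨I1, I2, I3, I4, k2r_ref_ko_flux_moment_le v I4, ?_⟩
  -- the identity: the iterated bracket is the product integral of `Y₀ ρ₀ (F₁' + F₂ − F₃' − F₃)`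
  have I12 : Integrable (fun p : Metric.sphere (0 : V3) 1 × V3 =>
      max ⟪v - p.2, (p.1 : V3)⟫_ℝ 0 * globalMaxwellian p.2 * g₁ (v - ⟪v - p.2, (p.1 : V3)⟫_ℝ • (p.1 : V3)) +
      max ⟪v - p.2, (p.1 : V3)⟫_ℝ 0 * globalMaxwellian p.2 *
        g₂ (p.1, p.2 + ⟪v - p.2, (p.1 : V3)⟫_ℝ • (p.1 : V3)))
      ((sphereMeasure : Measure (Metric.sphere (0 : V3) 1)).prod volume) := I1'.add I2
  have I123 : Integrable (fun p : Metric.sphere (0 : V3) 1 × V3 =>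
      max ⟪v - p.2, (p.1 : V3)⟫_ℝ 0 * globalMaxwellian p.2 * g₁ (v - ⟪v - p.2, (p.1 : V3)⟫_ℝ • (p.1 : V3)) +
      max ⟪v - p.2, (p.1 : V3)⟫_ℝ 0 * globalMaxwellian p.2 *
        g₂ (p.1, p.2 + ⟪v - p.2, (p.1 : V3)⟫_ℝ • (p.1 : V3)) -
      max ⟪v - p.2, (p.1 : V3)⟫_ℝ 0 * globalMaxwellian p.2 * g₁ v)
      ((sphereMeasure : Measure (Metric.sphere (0 : V3) 1)).prod volume) := I12.sub I3'
  have hF : Integrable (fun p : Metric.sphere (0 : V3) 1 × V3 =>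
      max ⟪v - p.2, (p.1 : V3)⟫_ℝ 0 * Y₀ * (ρ₀ * globalMaxwellian p.2) *
        (g₁ (v - ⟪v - p.2, (p.1 : V3)⟫_ℝ • (p.1 : V3)) + g₂ (p.1, p.2 + ⟪v - p.2, (p.1 : V3)⟫_ℝ • (p.1 : V3)) -
          g₁ v - g₂ (p.1, p.2)))
      ((sphereMeasure : Measure (Metric.sphere (0 : V3) 1)).prod volume) := by
    refine ((I123.sub I3).const_mul (Y₀ * ρ₀)).congr (Eventually.of_forall fun p => ?_)
    simp only [Pi.sub_apply]
    ring
  rw [← integral_prod _ hF]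
  have e1 : ∫ p : Metric.sphere (0 : V3) 1 × V3,
      max ⟪v - p.2, (p.1 : V3)⟫_ℝ 0 * Y₀ * (ρ₀ * globalMaxwellian p.2) *
        (g₁ (v - ⟪v - p.2, (p.1 : V3)⟫_ℝ • (p.1 : V3)) + g₂ (p.1, p.2 + ⟪v - p.2, (p.1 : V3)⟫_ℝ • (p.1 : V3)) -
          g₁ v - g₂ (p.1, p.2)) ∂((sphereMeasure : Measure (Metric.sphere (0 : V3) 1)).prod volume) =
      ∫ p : Metric.sphere (0 : V3) 1 × V3, Y₀ * ρ₀ *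
        (max ⟪v - p.2, (p.1 : V3)⟫_ℝ 0 * globalMaxwellian p.2 * g₁ (v - ⟪v - p.2, (p.1 : V3)⟫_ℝ • (p.1 : V3)) +
          max ⟪v - p.2, (p.1 : V3)⟫_ℝ 0 * globalMaxwellian p.2 *
            g₂ (p.1, p.2 + ⟪v - p.2, (p.1 : V3)⟫_ℝ • (p.1 : V3)) -
          max ⟪v - p.2, (p.1 : V3)⟫_ℝ 0 * globalMaxwellian p.2 * g₁ v -
          max ⟪v - p.2, (p.1 : V3)⟫_ℝ 0 * globalMaxwellian p.2 * g₂ (p.1, p.2))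
        ∂((sphereMeasure : Measure (Metric.sphere (0 : V3) 1)).prod volume) :=
    integral_congr_ae (Eventually.of_forall fun p => by ring)
  rw [e1, integral_const_mul, integral_sub I123 I3, integral_sub I12 I3', integral_add I1' I2,
    k2r_ref_ko_exchange hg₁.measurable v I1' I1, k2r_ref_ko_loss v (g₁ v) I0]

end Summit.AtomisticToContinuum.HydrodynamicLimit.Theorems.EnskogAdjointDuality
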